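import Literature.AlgebraicGeometry.Frobenioids.DivisorMonoidCategoryTheoreticityThm42
import Literature.AlgebraicGeometry.Frobenioids.PerfFactorialWeak
import HarnessLib

/-!
# [FrdI] Theorem 4.2 (iii): the right-hand and left-hand monoid isomorphisms `Φ₁(A)_𝔭 ≅ Φ₂(Ψ A)_{𝔭'}` — for
# WEAKLY perf-factorial divisor monoids

Mochizuki, *The geometry of Frobenioids I: the general theory*, Kyushu J. Math. **62** (2008) 293–400, §4,
Theorem 4.2 (iii), statement p. 78, proof p. 81 ll. 32–58 (kurims) [cite: MochizukiFrdI2008, Thm. 4.2 (iii) p.78]: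
"… it follows that the equivalences of categories in question arise from bijections of sets … compatible both
with `≤` and with multiplication by elements of `ℕ≥1` … [hence] isomorphisms of monoids."

PROOF-ONLY file (cell abc-iut, layer L1, node `FrdI:Thm4.2`; seat abc-iut-L1-t12, row «Thm. 4.2 chain over
`IsPerfFactorialWeak`», L1-lead R129).  Verbatim ports of `PreFrobenioid.exists_rightIso` / `exists_leftIso`
(`PrimesMonoidIso{Right,Left}.lean`, seat abc-iut-L1-t14) and of `PreFrobenioidData.thm42iii_of`
(`DivisorMonoidCategoryTheoreticityThm42.lean`), with `Objectwise IsPerfFactorial` replaced by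
`Objectwise IsPerfFactorialWeak` — of which ONLY clause (b) "every `Φ(A)_𝔭` is monoprime" is used, for the monoid
kernel `IsMonoprime.nonempty_mulEquiv_of_dvd_iff_of_pow` (seat abc-iut-L1-d10); printed case via
`IsPerfFactorial.weak`:
* `PreFrobenioid.exists_rightIso_weak`, `PreFrobenioid.exists_leftIso_weak`;
* `PreFrobenioidData.thm42iii_of_weak` — the typed `Thm42iii e` from Thm. 3.4 (ii)(iii), the Div-identity clause of
  Thm. 4.2 (i) and the two clauses of Thm. 4.2 (ii) for `e`, all as hypotheses.
No new definitions; no landed declaration touched; nothing of the paper restated or strengthened.  HONEST FRAMING: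
classical [FrdI] §4 algebra; nothing here bears on [IUTchIII] Cor. 3.12.
-/

namespace Literature.AlgebraicGeometry.Frobenioids

open CategoryTheory Opposite

namespace PreFrobenioid

universe w v v' u u' w₂ v₂ v₂' u₂ u₂'

variable {D : Type u} [Category.{v} D] {Φ : Dᵒᵖ ⥤ CommMonCat.{w}}
  {C : Type u'} [Category.{v'} C] {F : C ⥤ ElemFrobenioid Φ}
  {D₂ : Type u₂} [Category.{v₂} D₂] {Φ₂ : D₂ᵒᵖ ⥤ CommMonCat.{w₂}}
  {C₂ : Type u₂'} [Category.{v₂'} C₂] {F₂ : C₂ ⥤ ElemFrobenioid Φ₂} (Ψ : C ≌ C₂)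

set_option backward.isDefEq.respectTransparency false in
/-- **Theorem 4.2 (iii), the right-hand isomorphism, weakly perf-factorial divisor monoids** (FrdI p. 78, proof
p. 81): for Frobenioids of isotropic type with `Φ_i` WEAKLY perf-factorial, an equivalence `Ψ` with `Ψ`, `Ψ⁻¹`
preserving pre-steps and `Ψ` preserving morphisms of Frobenius type, Frobenius degrees and the Div-identity
endomorphisms of `A`, a Div-Frobenius-trivial `A`, and primes `𝔭` of `Φ₁(A)`, `𝔭'` of `Φ₂(Ψ A)` corresponding as in
Thm. 4.2 (ii) (a): an ISOMORPHISM OF MONOIDS `r : Φ₁(A)_𝔭 ≃* Φ₂(Ψ A)_{𝔭'}` with `r(Div φ) = Div(Ψ φ)` for every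
co-angular pre-step `φ : A → B` with `Div φ ∈ Φ₁(A)_𝔭`.  Port of `exists_rightIso` (only Def. 2.4 (i)(b) is used).
[cite: MochizukiFrdI2008, Thm. 4.2 (iii) p.78] -/
theorem exists_rightIso_weak (hF : IsFrobenioid F) (hF₂ : IsFrobenioid F₂)
    (histr : IsOfIsotropicType F) (histr₂ : IsOfIsotropicType F₂)
    (hpf : Objectwise (fun M _ => IsPerfFactorialWeak M) Φ)
    (hpf₂ : Objectwise (fun M _ => IsPerfFactorialWeak M) Φ₂)
    (hpre : ∀ ⦃X Y : C⦄ (φ : X ⟶ Y), IsPreStep F φ → IsPreStep F₂ (Ψ.functor.map φ))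
    (hpre' : ∀ ⦃X Y : C₂⦄ (φ : X ⟶ Y), IsPreStep F₂ φ → IsPreStep F (Ψ.inverse.map φ))
    (hfrob : ∀ ⦃X Y : C⦄ (φ : X ⟶ Y), IsFrobeniusType F φ → IsFrobeniusType F₂ (Ψ.functor.map φ))
    (hdeg : ∀ ⦃X Y : C⦄ (φ : X ⟶ Y), degFr F₂ (Ψ.functor.map φ) = degFr F φ)
    {A : C} (hA : IsDivFrobeniusTrivial F A)
    (hdivid : ∀ α : A ⟶ A, IsDivIdentity F α → IsDivIdentity F₂ (Ψ.functor.map α))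
    (𝔭 : Primes (Φ.obj (op (baseObj F A)))) (𝔭' : Primes (Φ₂.obj (op (baseObj F₂ (Ψ.functor.obj A)))))
    (he : ∀ ⦃B : C⦄ (φ : A ⟶ B), IsCoAngularPreStep F φ →
      (Div F φ ∈ 𝔭.submonoid ↔ Div F₂ (Ψ.functor.map φ) ∈ 𝔭'.submonoid)) :
    ∃ r : 𝔭.submonoid ≃* 𝔭'.submonoid, ∀ ⦃B : C⦄ (φ : A ⟶ B), IsCoAngularPreStep F φ →
      ∀ h : Div F φ ∈ 𝔭.submonoid,
        (r ⟨Div F φ, h⟩ : Φ₂.obj (op (baseObj F₂ (Ψ.functor.obj A)))) = Div F₂ (Ψ.functor.map φ) := by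
  have hP := hF.isPreFrobenioid
  have hP₂ := hF₂.isPreFrobenioid
  have hco : ∀ {X Y : C} (f : X ⟶ Y), IsCoAngular F f :=
    fun f => isCoAngular_of_isIsotropic_codomains F f fun Z _ => histr Z
  choose Bo φo hφo hφox using fun y : Φ.obj (op (baseObj F A)) => hF.iii_d_under_surj A y
  let f : 𝔭.submonoid → 𝔭'.submonoid :=
    fun y => ⟨Div F₂ (Ψ.functor.map (φo y)), (he (φo y) (hφo y)).mp (by rw [hφox]; exact y.2)⟩
  have hkey : ∀ (y : 𝔭.submonoid) ⦃B : C⦄ (φ : A ⟶ B) (hφ : IsPreStep F φ), Div F φ = y →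
      (f y : Φ₂.obj (op (baseObj F₂ (Ψ.functor.obj A)))) = Div F₂ (Ψ.functor.map φ) := by
    intro y B φ hφ hx
    exact (div_eq_iff_map Ψ hF hF₂ histr histr₂ hpre hpre' (hφo y).2 hφ).mp ((hφox y).trans hx.symm)
  have hdvd : ∀ x y : 𝔭.submonoid, x ∣ y ↔ f x ∣ f y := by
    intro x y
    rw [Primes.subtype_dvd_iff, Primes.subtype_dvd_iff, ← hφox x, ← hφox y]
    exact div_dvd_iff_map Ψ hF hF₂ histr histr₂ hpre hpre' (hφo x).2 (hφo y).2
  obtain ⟨ζ, hζ⟩ := hA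
  have hζ' : ∀ n : ℕ+, ∃ α : A ⟶ A, degFr F α = n ∧ IsDivIdentity F α ∧ IsFrobeniusType F α :=
    fun n => ⟨ζ n, hζ n⟩
  have hpow : ∀ (y : 𝔭.submonoid) (n : ℕ+), f (y ^ (n : ℕ)) = f y ^ (n : ℕ) := by
    intro y n
    obtain ⟨α, hdegα, hαd, hαf⟩ := hζ' n
    obtain ⟨B', β, φ', hβ, hdegβ, hφ', hsq⟩ := exists_square_out hF (hφo y).2 hαf
    have hx' : Div F φ' = (y : Φ.obj (op (baseObj F A))) ^ (n : ℕ) := by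
      rw [div_eq_pow_of_square hαd hαf.1.2 hβ.1.2 hsq, hφox, hdegβ, hdegα]
    have hsq₂ : Ψ.functor.map α ≫ Ψ.functor.map φ' = Ψ.functor.map (φo y) ≫ Ψ.functor.map β := by
      rw [← Functor.map_comp, hsq, Functor.map_comp]
    have hx₂ := div_eq_pow_of_square (F := F₂) (hdivid _ hαd) (hfrob _ hαf).1.2 (hfrob _ hβ).1.2 hsq₂
    rw [hdeg, hdegβ, hdegα] at hx₂
    apply Subtype.ext
    rw [hkey (y ^ (n : ℕ)) φ' hφ' hx', hx₂]
    rfl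
  have hinj : Function.Injective f := by
    intro x y hxy
    have h1 : Div F₂ (Ψ.functor.map (φo x)) = Div F₂ (Ψ.functor.map (φo y)) := congrArg Subtype.val hxy
    have h2 := (div_eq_iff_map Ψ hF hF₂ histr histr₂ hpre hpre' (hφo x).2 (hφo y).2).mpr h1
    exact Subtype.ext (by rw [← hφox x, ← hφox y, h2])
  have hsurj : Function.Surjective f := by
    intro z
    obtain ⟨Z, ξ, hξ, hξx⟩ := hF₂.iii_d_under_surj (Ψ.functor.obj A) z.1
    set ξ₁ : A ⟶ Ψ.inverse.obj Z := Ψ.unit.app A ≫ Ψ.inverse.map ξ with hξ₁def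
    have hξ₁ : IsPreStep F ξ₁ := IsPreStep.comp F (isPreStep_of_isIso F _) (hpre' ξ hξ.2)
    have e1 : Ψ.functor.map ξ₁ = ξ ≫ Ψ.counitInv.app Z := by
      rw [hξ₁def, Functor.map_comp, Ψ.fun_inv_map, ← Category.assoc, Ψ.functor_unit_comp,
        Category.id_comp]
    have hx₁ : Div F₂ (Ψ.functor.map ξ₁) = z.1 := by rw [e1, div_comp_iso hP₂, hξx]
    have hy : Div F ξ₁ ∈ 𝔭.submonoid := (he ξ₁ ⟨hco _, hξ₁⟩).mpr (hx₁ ▸ z.2)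
    refine ⟨⟨Div F ξ₁, hy⟩, Subtype.ext ?_⟩
    rw [hkey ⟨Div F ξ₁, hy⟩ ξ₁ hξ₁ rfl, hx₁]
  -- the monoid kernel (seat abc-iut-L1-d10); Def. 2.4 (i)(b) on both sides
  obtain ⟨r, hr⟩ := IsMonoprime.nonempty_mulEquiv_of_dvd_iff_of_pow ((hpf _).isMonoprime 𝔭)
    ((hpf₂ _).isMonoprime 𝔭') (Equiv.ofBijective f ⟨hinj, hsurj⟩) hdvd hpow
  refine ⟨r, fun B φ hφ h => ?_⟩
  rw [hr, Equiv.ofBijective_apply, hkey ⟨Div F φ, h⟩ φ hφ.2 rfl]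

set_option backward.isDefEq.respectTransparency false in
/-- **Theorem 4.2 (iii), the left-hand isomorphism, weakly perf-factorial divisor monoids** (FrdI p. 78, proof
p. 81): under the hypotheses of `exists_rightIso_weak` and primes `𝔭` of `Φ₁(A)`, `𝔭'` of `Φ₂(Ψ A)` corresponding as
in Thm. 4.2 (ii) (b), an ISOMORPHISM OF MONOIDS `l : Φ₁(A)_𝔭 ≃* Φ₂(Ψ A)_{𝔭'}` with `(Ψψ)_*Div(Ψψ) = l(y)` for every
co-angular pre-step `ψ : B → A` with `ψ_*Div(ψ) = y ∈ Φ₁(A)_𝔭`.  Port of `exists_leftIso` (only Def. 2.4 (i)(b) is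
used). [cite: MochizukiFrdI2008, Thm. 4.2 (iii) p.78] -/
theorem exists_leftIso_weak (hF : IsFrobenioid F) (hF₂ : IsFrobenioid F₂)
    (histr : IsOfIsotropicType F) (histr₂ : IsOfIsotropicType F₂)
    (hpf : Objectwise (fun M _ => IsPerfFactorialWeak M) Φ)
    (hpf₂ : Objectwise (fun M _ => IsPerfFactorialWeak M) Φ₂)
    (hpre : ∀ ⦃X Y : C⦄ (φ : X ⟶ Y), IsPreStep F φ → IsPreStep F₂ (Ψ.functor.map φ))
    (hpre' : ∀ ⦃X Y : C₂⦄ (φ : X ⟶ Y), IsPreStep F₂ φ → IsPreStep F (Ψ.inverse.map φ))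
    (hfrob : ∀ ⦃X Y : C⦄ (φ : X ⟶ Y), IsFrobeniusType F φ → IsFrobeniusType F₂ (Ψ.functor.map φ))
    (hdeg : ∀ ⦃X Y : C⦄ (φ : X ⟶ Y), degFr F₂ (Ψ.functor.map φ) = degFr F φ)
    {A : C} (hA : IsDivFrobeniusTrivial F A)
    (hdivid : ∀ α : A ⟶ A, IsDivIdentity F α → IsDivIdentity F₂ (Ψ.functor.map α))
    (𝔭 : Primes (Φ.obj (op (baseObj F A)))) (𝔭' : Primes (Φ₂.obj (op (baseObj F₂ (Ψ.functor.obj A)))))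
    (he : ∀ ⦃B : C⦄ (ψ : B ⟶ A), IsCoAngularPreStep F ψ →
      ((∃ y ∈ 𝔭.submonoid, pull Φ (Base F ψ) y = Div F ψ) ↔
        ∃ y ∈ 𝔭'.submonoid, pull Φ₂ (Base F₂ (Ψ.functor.map ψ)) y = Div F₂ (Ψ.functor.map ψ))) :
    ∃ l : 𝔭.submonoid ≃* 𝔭'.submonoid, ∀ ⦃B : C⦄ (ψ : B ⟶ A), IsCoAngularPreStep F ψ →
      ∀ (y : Φ.obj (op (baseObj F A))) (h : y ∈ 𝔭.submonoid), pull Φ (Base F ψ) y = Div F ψ →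
        pull Φ₂ (Base F₂ (Ψ.functor.map ψ)) (l ⟨y, h⟩ : Φ₂.obj (op (baseObj F₂ (Ψ.functor.obj A)))) =
          Div F₂ (Ψ.functor.map ψ) := by
  have hP := hF.isPreFrobenioid
  have hP₂ := hF₂.isPreFrobenioid
  have hco : ∀ {X Y : C} (f : X ⟶ Y), IsCoAngular F f :=
    fun f => isCoAngular_of_isIsotropic_codomains F f fun Z _ => histr Z
  choose Bo ψo hψo hψox using fun y : Φ.obj (op (baseObj F A)) => hF.iii_d_over_surj A y
  have hΨψo : ∀ y, IsPreStep F₂ (Ψ.functor.map (ψo y)) := fun y => hpre _ (hψo y).2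
  have hmem : ∀ y : 𝔭.submonoid, invDiv F₂ (Ψ.functor.map (ψo y)) (hΨψo y).2 ∈ 𝔭'.submonoid := by
    intro y
    haveI : IsIso (Base F₂ (Ψ.functor.map (ψo y))) := (hΨψo y).2
    have hw : pull Φ (Base F (ψo y)) (y : Φ.obj (op (baseObj F A))) = Div F (ψo y) := by
      have h := pull_invDiv (ψo (y : Φ.obj (op (baseObj F A)))) (hψo y).2.2
      rwa [hψox] at h
    obtain ⟨y₂, hy₂, e₂⟩ := (he (ψo y) (hψo y)).mp ⟨y, y.2, hw⟩
    have hy₂' : y₂ = invDiv F₂ (Ψ.functor.map (ψo y)) (hΨψo y).2 :=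
      pull_injective_of_isIso Φ₂ (Base F₂ (Ψ.functor.map (ψo y))) (by rw [e₂, pull_invDiv])
    rwa [hy₂'] at hy₂
  let f : 𝔭.submonoid → 𝔭'.submonoid := fun y => ⟨_, hmem y⟩
  have hkey : ∀ (y : 𝔭.submonoid) ⦃B : C⦄ (ψ : B ⟶ A) (hψ : IsPreStep F ψ),
      invDiv F ψ hψ.2 = y → (f y : Φ₂.obj (op (baseObj F₂ (Ψ.functor.obj A)))) =
        invDiv F₂ (Ψ.functor.map ψ) (hpre ψ hψ).2 := by
    intro y B ψ hψ hx
    exact (invDiv_eq_iff_map Ψ hF hF₂ histr histr₂ hpre hpre' hψ (hψo y).2).mp ((hψox y).trans hx.symm)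
  have hdvd : ∀ x y : 𝔭.submonoid, x ∣ y ↔ f x ∣ f y := by
    intro x y
    rw [Primes.subtype_dvd_iff, Primes.subtype_dvd_iff, ← hψox x, ← hψox y]
    exact invDiv_dvd_iff_map Ψ hF hF₂ histr histr₂ hpre hpre' (hψo y).2 (hψo x).2
  obtain ⟨ζ, hζ⟩ := hA
  have hζ' : ∀ n : ℕ+, ∃ α : A ⟶ A, degFr F α = n ∧ IsDivIdentity F α ∧ IsFrobeniusType F α :=
    fun n => ⟨ζ n, hζ n⟩
  have hpow : ∀ (y : 𝔭.submonoid) (n : ℕ+), f (y ^ (n : ℕ)) = f y ^ (n : ℕ) := by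
    intro y n
    obtain ⟨α, hdegα, hαd, hαf⟩ := hζ' n
    have hbi : IsBaseIso F (ψo y ≫ α) := IsBaseIso.comp F (hψo y).2.2 hαf.2
    obtain ⟨X, β, ψ', hfac, hβ, hψ'⟩ := (isBaseIso_iff_exists_frobeniusType_preStep F hF (ψo y ≫ α)).mp hbi
    have hx' : invDiv F ψ' hψ'.2 = (y : Φ.obj (op (baseObj F A))) ^ (n : ℕ) := by
      rw [invDiv_eq_pow_of_square (hψo y).2 hαd hαf.1.2 hβ.1.2 hψ' hfac.symm hbi, hψox, hdegα]
    have hsq₂ : Ψ.functor.map (ψo y) ≫ Ψ.functor.map α = Ψ.functor.map β ≫ Ψ.functor.map ψ' := by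
      rw [← Functor.map_comp, ← hfac, Functor.map_comp]
    have hbi₂ : IsBaseIso F₂ (Ψ.functor.map (ψo y) ≫ Ψ.functor.map α) :=
      IsBaseIso.comp F₂ (hΨψo y).2 (hfrob _ hαf).2
    have hx₂ := invDiv_eq_pow_of_square (F := F₂) (hΨψo y) (hdivid _ hαd) (hfrob _ hαf).1.2
      (hfrob _ hβ).1.2 (hpre ψ' hψ') hsq₂ hbi₂
    rw [hdeg, hdegα] at hx₂
    apply Subtype.ext
    rw [hkey (y ^ (n : ℕ)) ψ' hψ' hx', hx₂]
    rfl
  have hinj : Function.Injective f := by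
    intro x y hxy
    have h1 : invDiv F₂ (Ψ.functor.map (ψo x)) (hΨψo x).2 = invDiv F₂ (Ψ.functor.map (ψo y)) (hΨψo y).2 :=
      congrArg Subtype.val hxy
    have h2 := (invDiv_eq_iff_map Ψ hF hF₂ histr histr₂ hpre hpre' (hψo y).2 (hψo x).2).mpr h1
    exact Subtype.ext (by rw [← hψox x, ← hψox y, h2])
  have hsurj : Function.Surjective f := by
    intro z
    obtain ⟨Z, ξ, hξ, hξx⟩ := hF₂.iii_d_over_surj (Ψ.functor.obj A) z.1
    set ξ₁ : Ψ.inverse.obj Z ⟶ A := Ψ.inverse.map ξ ≫ Ψ.unitInv.app A with hξ₁def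
    have hξ₁ : IsPreStep F ξ₁ := IsPreStep.comp F (hpre' ξ hξ.2) (isPreStep_of_isIso F _)
    have hΨξ₁ : IsPreStep F₂ (Ψ.functor.map ξ₁) := hpre _ hξ₁
    have e1 : Ψ.functor.map ξ₁ = Ψ.counit.app Z ≫ ξ := by
      rw [hξ₁def, Functor.map_comp, Ψ.fun_inv_map, Category.assoc, Category.assoc,
        Ψ.counitInv_functor_comp, Category.comp_id]
    have hb' : IsBaseIso F₂ (Ψ.counit.app Z ≫ ξ) := e1 ▸ hΨξ₁.2
    have hx₁ : invDiv F₂ (Ψ.functor.map ξ₁) hΨξ₁.2 = z.1 := by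
      rw [show invDiv F₂ (Ψ.functor.map ξ₁) hΨξ₁.2 = invDiv F₂ (Ψ.counit.app Z ≫ ξ) hb' from by congr 1,
        invDiv_iso_comp hP₂ _ _ hξ.2.2 hb', hξx]
    haveI : IsIso (Base F₂ (Ψ.functor.map ξ₁)) := hΨξ₁.2
    haveI : IsIso (Base F ξ₁) := hξ₁.2
    obtain ⟨y, hy, hyx⟩ := (he ξ₁ ⟨hco _, hξ₁⟩).mpr ⟨z.1, z.2, by rw [← hx₁, pull_invDiv]⟩
    have hy' : y = invDiv F ξ₁ hξ₁.2 := pull_injective_of_isIso Φ (Base F ξ₁) (by rw [hyx, pull_invDiv])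
    refine ⟨⟨y, hy⟩, Subtype.ext ?_⟩
    rw [hkey ⟨y, hy⟩ ξ₁ hξ₁ hy'.symm, hx₁]
  -- the monoid kernel (seat abc-iut-L1-d10); Def. 2.4 (i)(b) on both sides
  obtain ⟨l, hl⟩ := IsMonoprime.nonempty_mulEquiv_of_dvd_iff_of_pow ((hpf _).isMonoprime 𝔭)
    ((hpf₂ _).isMonoprime 𝔭') (Equiv.ofBijective f ⟨hinj, hsurj⟩) hdvd hpow
  refine ⟨l, fun B ψ hψ y h hyx => ?_⟩
  haveI : IsIso (Base F ψ) := hψ.2.2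
  haveI : IsIso (Base F₂ (Ψ.functor.map ψ)) := (hpre ψ hψ.2).2
  have hy' : invDiv F ψ hψ.2.2 = y := (pull_injective_of_isIso Φ (Base F ψ) (by rw [hyx, pull_invDiv])).symm
  rw [hl, Equiv.ofBijective_apply, hkey ⟨y, h⟩ ψ hψ.2 hy', pull_invDiv]

end PreFrobenioid

/-! ### Theorem 4.2 (iii) as typed, from its printed inputs, weak hypothesis -/

namespace PreFrobenioidData

universe w v v' u u' w₂ v₂ v₂' u₂ u₂'

variable {D : Type u} [Category.{v} D] {Φ : Dᵒᵖ ⥤ CommMonCat.{w}} {C : Type u'} [Category.{v'} C]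
  {F : C ⥤ ElemFrobenioid Φ}
  {D₂ : Type u₂} [Category.{v₂} D₂] {Φ₂ : D₂ᵒᵖ ⥤ CommMonCat.{w₂}} {C₂ : Type u₂'}
  [Category.{v₂'} C₂] {F₂ : C₂ ⥤ ElemFrobenioid Φ₂} (Ψ : C ≌ C₂)

/-- **Theorem 4.2 (iii) as typed (`Thm42iii`), weakly perf-factorial divisor monoids, conditional on Thm. 3.4
(ii)(iii), the Div-identity clause of Thm. 4.2 (i) and the conclusion of Thm. 4.2 (ii) for the family `e`** — all
HYPOTHESES: for Div-Frobenius-trivial `A` and every `𝔭`, the right-hand and left-hand isomorphisms of monoids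
`Φ₁(A)_𝔭 ≃* Φ₂(Ψ A)_{e A 𝔭}`.  Port of `thm42iii_of` (seat abc-iut-L1-t14) over `exists_rightIso_weak` /
`exists_leftIso_weak`. [cite: MochizukiFrdI2008, Thm. 4.2 (iii) p.78] -/
theorem thm42iii_of_weak (hF : PreFrobenioid.IsFrobenioid F) (hF₂ : PreFrobenioid.IsFrobenioid F₂)
    (hpf : Objectwise (fun M _ => IsPerfFactorialWeak M) Φ)
    (hpf₂ : Objectwise (fun M _ => IsPerfFactorialWeak M) Φ₂)
    (hpre : ∀ ⦃X Y : C⦄ (φ : X ⟶ Y), PreFrobenioid.IsPreStep F φ →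
      PreFrobenioid.IsPreStep F₂ (Ψ.functor.map φ))
    (hpre' : ∀ ⦃X Y : C₂⦄ (φ : X ⟶ Y), PreFrobenioid.IsPreStep F₂ φ →
      PreFrobenioid.IsPreStep F (Ψ.inverse.map φ))
    (hfrob : ∀ ⦃X Y : C⦄ (φ : X ⟶ Y), PreFrobenioid.IsFrobeniusType F φ →
      PreFrobenioid.IsFrobeniusType F₂ (Ψ.functor.map φ))
    (hdeg : ∀ ⦃X Y : C⦄ (φ : X ⟶ Y), PreFrobenioid.degFr F₂ (Ψ.functor.map φ) = PreFrobenioid.degFr F φ)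
    (hdivid : ∀ (A : C) (α : A ⟶ A), PreFrobenioid.IsDivIdentity F α →
      PreFrobenioid.IsDivIdentity F₂ (Ψ.functor.map α))
    (e : ∀ A : C, Primes (Φ.obj (op (PreFrobenioid.baseObj F A))) ≃
      Primes (Φ₂.obj (op (PreFrobenioid.baseObj F₂ (Ψ.functor.obj A)))))
    (he : ∀ (A : C) (𝔭 : Primes (Φ.obj (op (PreFrobenioid.baseObj F A)))),
      (∀ ⦃B : C⦄ (φ : A ⟶ B), PreFrobenioid.IsCoAngularPreStep F φ →
          (PreFrobenioid.Div F φ ∈ 𝔭.submonoid ↔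
            PreFrobenioid.Div F₂ (Ψ.functor.map φ) ∈ (e A 𝔭).submonoid)) ∧
        ∀ ⦃B : C⦄ (ψ : B ⟶ A), PreFrobenioid.IsCoAngularPreStep F ψ →
          ((∃ y ∈ 𝔭.submonoid, Frobenioids.pull Φ (PreFrobenioid.Base F ψ) y = PreFrobenioid.Div F ψ) ↔
            ∃ y ∈ (e A 𝔭).submonoid, Frobenioids.pull Φ₂ (PreFrobenioid.Base F₂ (Ψ.functor.map ψ)) y =
              PreFrobenioid.Div F₂ (Ψ.functor.map ψ))) :
    (ofFunctor Φ F).Thm42iii (ofFunctor Φ₂ F₂) Ψ e := by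
  intro hS A hA 𝔭
  have histr := (ofFunctor_isOfIsotropicType F).mp hS.isotropic.1
  have histr₂ := (ofFunctor_isOfIsotropicType F₂).mp hS.isotropic.2
  have hA' := (ofFunctor_isDivFrobeniusTrivial F A).mp hA
  constructor
  · obtain ⟨r, hr⟩ := PreFrobenioid.exists_rightIso_weak Ψ hF hF₂ histr histr₂ hpf hpf₂ hpre hpre' hfrob hdeg
      hA' (hdivid A) 𝔭 (e A 𝔭) (he A 𝔭).1
    exact ⟨r, fun B φ hφ h => hr φ ((ofFunctor_isCoAngularPreStep F φ).mp hφ) h⟩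
  · obtain ⟨l, hl⟩ := PreFrobenioid.exists_leftIso_weak Ψ hF hF₂ histr histr₂ hpf hpf₂ hpre hpre' hfrob hdeg
      hA' (hdivid A) 𝔭 (e A 𝔭) (he A 𝔭).2
    exact ⟨l, fun B ψ hψ y h hyx => hl ψ ((ofFunctor_isCoAngularPreStep F ψ).mp hψ) y h hyx⟩

end PreFrobenioidData

end Literature.AlgebraicGeometry.Frobenioids
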